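import Summits.CriticalPhenomena.CardyFormulaZ2.Theorems.CardyComplexConeParafermionToSLESixFamiliesIicTouchAudit
import Summits.CriticalPhenomena.CardyFormulaZ2.Theorems.CardyComplexConeParafermionToSLESixFamiliesSlitBridge
import Summits.CriticalPhenomena.CardyFormulaZ2.Theorems.CardyComplexConeParafermionToSLESixFamiliesLimitSource
import HarnessLib

/-!
# The touch martingales of stub S6 are PINNED touch probabilities (line `iic-trace-flux-pairing`, crux `ParafermionToSLESixFamilies`, stmt-CriticalPhenomena-11389)

Route `CardyComplexCone` (sub-problem `CriticalPhenomena/CardyFormulaZ2`), crux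
`Summit.CriticalPhenomena.CardyFormulaZ2.Theses.CardyComplexCone.ParafermionToSLESixFamilies`, line
`iic-trace-flux-pairing`, stub S6 `stub_sleLawOnRectilinear :
(∀ D, IsRectilinear D → TouchLawPos D) → TightOnRectilinear ∧ IdentOnRectilinear` (vocabulary
`Theorems/CardyComplexConeParafermionToSLESixFamiliesIicDefs.lean`). The tightness half is
`…IicTight.lean`. This file is the AUDIT of the identification half, in Lean: it builds the exact objects
the intended proof ("Doob martingales of the MONOTONE touch events `P(x ↔ A ∣ γ[0,t]) = P_{D_t}(x ↔ A_t)` for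
`x` in a flat free window next to the target") manipulates, and shows what they are observables OF.

* §1 `touchEvent E x` (the monotone event `x ↔ A` of `touchProb`), the PINNED touch probability
  `touchProbPin E O C x = P_{1/2}{ω | (ω ∪ O) ∖ C ∈ touchEvent E x}` of the pinned datum `(E, O, C)` (`O` forced
  open, `C` forced closed), `touchProbPin_empty`, measurability, and the registered glue `touchProbPin_mono`
  (monotone in the pinned sets — inclusion of events, no FKG).
* §2 registered glue `real_explorationCylinder_inter_touchEvent` and `martingale_touchProbPin`: by the domain
  Markov property of the medial exploration under the product measure (`…PercDomainMarkov.lean`) read through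
  "freezing is pinning" (`…SlitBridge.freeze_eq_pin`), the conditional touch probability given the exploration
  prefix `C_n(ω₀)` is EXACTLY `touchProbPin E (ω₀ ∩ R_n) (R_n ∖ ω₀) x`, `R_n` the revealed free edges (followed
  edges pinned open, crossed edges pinned closed), and these form a martingale for the exploration filtration.
* §3 the random touch count `touchCount E g` (`δ^{2/3} Σ_{touch sites x ↔ A} g(δx)`), the pinned touch functional
  `touchFunctionalPin E O C g`, the registered glue `touchFunctional_eq_integral_touchCount` (the line's
  `touchFunctional` is its expectation) and `martingale_touchFunctionalPin` (its Doob martingale is the pinned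
  touch functional of the revealed data).
* §4 registered glue `ae_source_eq_of_isSubseqLimitLaw`: subsequential limit laws of the crux's interface
  functional `iface` are carried by curves from `a` (orientation bookkeeping for `IsSLELaw 6 D μ`; `iface` is the
  Literature's `bondInterfaceIn`, so `…LimitSource` applies verbatim).

CONSEQUENCE FOR S6 (recorded, nothing asserted). The martingales of §2–§3 are touch probabilities of PINNED data
`(E, O_n, C_n)` — critical percolation in the slit domain with EDGE-WISE boundary conditions inherited from the
prefix — which no admissible `DiscreteDobrushin` datum renders (`…SlitBridge.not_isZdAdmissible_rendering_of_pin`: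
a crossed edge whose right endpoint stays alive), on carriers `D ∖ γ[0, t]` that are neither rectilinear nor
fixed as the mesh goes to `0`. The hypothesis `TouchLawPos D` of S6 speaks only of `touchFunctional (Λ δ) g` along
admissible families `Λ` of the FIXED domain `D` (`IsFamily D Λ` forces `(Λ δ).Ω = D`), with an amplitude `c` allowed
to depend on family, window and subsequence; it therefore constrains the `n = 0` term of these martingales and
nothing else. What the identification consumes is a touch law for the pinned slit data, uniformly in the prefix,
with one amplitude — the statement `TouchLawPosPin` proposed to the lead in the session's audit file.
-/

noncomputable section

namespace Summit.CriticalPhenomena.CardyFormulaZ2.Cruxes.ParafermionToSLESixFamilies.IicTraceFluxPairing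

open scoped Topology
open Filter MeasureTheory Set
open Literature.Probability Literature.Probability.LatticeModels Literature.Probability.Percolation
open Literature.Probability.LatticeModels.DiscreteDobrushin
open Literature.Probability.RandomPlanarGeometry
open Summit.CriticalPhenomena.CardyFormulaZ2.Cruxes.ParafermionToSLESixFamilies.CaratheodoryNetSlitUniformity
  (Pc revealedFreeEdges freeze percSlitExpectation freeze_eq_pin percSlitExpectation_eq_integral_pin
    bondPercolation_real_explorationCylinder_inter martingale_percSlitExpectation
    condExp_explorationFiltration_ae_eq_percSlitExpectation ae_source_eq_of_tendsto_bondInterfaceIn)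

variable {E : DiscreteDobrushin}

/-! ### §1 The touch event and the pinned touch probability -/

/-- The TOUCH EVENT at `x`: `x` is joined to the wired arc `A` by an open path of the completed configuration
(the event whose `P_{1/2}`-probability is `touchProb E x`). -/
def touchEvent (E : DiscreteDobrushin) (x : Site 2) : Set (BondConfig (Site 2)) :=
  {ω | ∃ y ∈ E.zdArcA, (openGraph (E.bcBondConfig ω)).Reachable x y}

/-- `touchProb` is the probability of the touch event (definitional). -/
theorem touchProb_eq (E : DiscreteDobrushin) (x : Site 2) : touchProb E x = Pc.real (touchEvent E x) := rfl

/-- The PINNED touch probability of the pinned datum `(E, O, C)`: the `P_{1/2}`-probability that `x` is joined to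
`A` in the completed configuration of `ω` pinned open on `O` and closed on `C` — the touch probability "in the
slit domain with the boundary conditions inherited from an exploration prefix" (`O` = revealed followed edges,
`C` = revealed crossed edges), an object about which `TouchLawPos` (admissible families of a fixed domain) is
silent (`…SlitBridge.not_isZdAdmissible_rendering_of_pin`). -/
def touchProbPin (E : DiscreteDobrushin) (O C : Set (Sym2 (Site 2))) (x : Site 2) : ℝ :=
  Pc.real {ω | (ω ∪ O) \ C ∈ touchEvent E x}

/-- With nothing pinned the pinned touch probability is the touch probability. -/
theorem touchProbPin_empty (E : DiscreteDobrushin) (x : Site 2) : touchProbPin E ∅ ∅ x = touchProb E x := by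
  simp [touchProbPin, touchProb_eq]

/-- The touch event is measurable (`…IicTouchAudit.measurableSet_touchEvent`, restated for the named event). -/
theorem touchEvent_measurableSet (E : DiscreteDobrushin) (x : Site 2) : MeasurableSet (touchEvent E x) :=
  measurableSet_touchEvent E x

/-- The touch event is increasing (a monotone event). -/
theorem touchEvent_mono (E : DiscreteDobrushin) (x : Site 2) {ω ω' : BondConfig (Site 2)} (h : ω ⊆ ω')
    (hω : ω ∈ touchEvent E x) : ω' ∈ touchEvent E x := by
  obtain ⟨y, hy, hxy⟩ := hω
  refine ⟨y, hy, hxy.mono ?_⟩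
  intro u v huv
  rw [openGraph_adj] at huv ⊢
  exact ⟨E.bcBondConfig_mono h huv.1, huv.2⟩

/-- The pinned touch event is measurable. -/
theorem measurableSet_pin_mem_touchEvent (E : DiscreteDobrushin) (O C : Set (Sym2 (Site 2))) (x : Site 2) :
    MeasurableSet {ω : BondConfig (Site 2) | (ω ∪ O) \ C ∈ touchEvent E x} :=
  CaratheodoryNetSlitUniformity.measurable_pin O C (touchEvent_measurableSet E x)

/-- **Monotonicity of the pinned touch probability in the pinned sets**: pinning more edges open and fewer
edges closed increases it (inclusion of events; no FKG needed). -/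
theorem touchProbPin_mono : ∀ (E : DiscreteDobrushin) (x : Site 2) {O O' C C' : Set (Sym2 (Site 2))}, O ⊆ O' → C' ⊆ C → touchProbPin E O C x ≤ touchProbPin E O' C' x := by
  intro E x O O' C C' hO hC
  refine measureReal_mono (fun ω hω => ?_)
  exact touchEvent_mono E x (Set.sdiff_subset_sdiff (Set.union_subset_union_right _ hO) hC) hω

/-- The pinned touch probability is a probability. -/
theorem touchProbPin_nonneg (E : DiscreteDobrushin) (O C : Set (Sym2 (Site 2))) (x : Site 2) :
    0 ≤ touchProbPin E O C x := measureReal_nonneg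

/-- The pinned touch probability is at most one. -/
theorem touchProbPin_le_one (E : DiscreteDobrushin) (O C : Set (Sym2 (Site 2))) (x : Site 2) :
    touchProbPin E O C x ≤ 1 :=
  measureReal_le_one

/-! ### §2 The conditional touch probability given an exploration prefix is the pinned touch probability -/

/-- **Conditional touch probabilities are pinned touch probabilities (atom form).** For admissible `E`, every
`ω₀`, depth `n` and site `x`: `P(C_n(ω₀) ∩ {x ↔ A}) = P(C_n(ω₀)) · touchProbPin E (ω₀ ∩ R) (R ∖ ω₀) x`, `R` the
revealed free edges of the prefix event `C_n(ω₀)` — the domain Markov property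
(`bondPercolation_real_explorationCylinder_inter`) read through `freeze = pin` (`freeze_eq_pin`). -/
theorem real_explorationCylinder_inter_touchEvent : ∀ {E : DiscreteDobrushin} (hE : E.IsZdAdmissible) (ω₀ : BondConfig (Site 2)) (n : ℕ) (x : Site 2), Pc.real (explorationCylinder hE ω₀ n ∩ touchEvent E x) = Pc.real (explorationCylinder hE ω₀ n) * touchProbPin E (ω₀ ∩ revealedFreeEdges hE ω₀ n) (revealedFreeEdges hE ω₀ n \ ω₀) x := by
  intro E hE ω₀ n x
  rw [bondPercolation_real_explorationCylinder_inter (hD := hE) half ω₀ n (touchEvent_measurableSet E x)]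
  congr 2
  ext ω
  simp only [Set.mem_preimage, freeze_eq_pin, Set.mem_setOf_eq]

/-- **The slit expectation of the touch indicator is the pinned touch probability.** -/
theorem percSlitExpectation_indicator_touchEvent (hE : E.IsZdAdmissible) (n : ℕ) (x : Site 2)
    (ω₀ : BondConfig (Site 2)) :
    percSlitExpectation hE half n ((touchEvent E x).indicator (1 : BondConfig (Site 2) → ℝ)) ω₀ =
      touchProbPin E (ω₀ ∩ revealedFreeEdges hE ω₀ n) (revealedFreeEdges hE ω₀ n \ ω₀) x := by
  rw [percSlitExpectation_eq_integral_pin, touchProbPin,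
    ← integral_indicator_one (measurableSet_pin_mem_touchEvent E _ _ x)]
  refine integral_congr_ae (ae_of_all _ fun ω => ?_)
  show (touchEvent E x).indicator (1 : BondConfig (Site 2) → ℝ) _ =
    {ω : BondConfig (Site 2) | (ω ∪ ω₀ ∩ revealedFreeEdges hE ω₀ n) \ (revealedFreeEdges hE ω₀ n \ ω₀) ∈
      touchEvent E x}.indicator 1 ω
  set T : Set (BondConfig (Site 2)) :=
    {ω | (ω ∪ ω₀ ∩ revealedFreeEdges hE ω₀ n) \ (revealedFreeEdges hE ω₀ n \ ω₀) ∈ touchEvent E x} with hT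
  by_cases hω : (ω ∪ ω₀ ∩ revealedFreeEdges hE ω₀ n) \ (revealedFreeEdges hE ω₀ n \ ω₀) ∈ touchEvent E x
  · have hωT : ω ∈ T := hω
    rw [Set.indicator_of_mem hω, Set.indicator_of_mem hωT]
    rfl
  · have hωT : ω ∉ T := hω
    rw [Set.indicator_of_notMem hω, Set.indicator_of_notMem hωT]

/-- **The touch martingale.** For admissible `E` and every site `x`, the conditional touch probabilities
`n ↦ (ω₀ ↦ touchProbPin E (ω₀ ∩ R_n) (R_n ∖ ω₀) x)` — the pinned touch probabilities of the data revealed by the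
first `n` steps of the medial exploration — form a martingale for the exploration filtration under `P_{1/2}`:
the "EXACT Doob martingale of the MONOTONE touch event" of stub S6, correctly typed as an observable of PINNED
data `(E, O, C)`, not of an admissible datum. -/
theorem martingale_touchProbPin : ∀ {E : DiscreteDobrushin} (hE : E.IsZdAdmissible) (x : Site 2), Martingale (fun n (ω₀ : BondConfig (Site 2)) => touchProbPin E (ω₀ ∩ revealedFreeEdges hE ω₀ n) (revealedFreeEdges hE ω₀ n \ ω₀) x) (explorationFiltration hE) Pc := by
  intro E hE x
  have hm : StronglyMeasurable ((touchEvent E x).indicator (1 : BondConfig (Site 2) → ℝ)) :=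
    (stronglyMeasurable_const (b := (1 : ℝ))).indicator (touchEvent_measurableSet E x)
  have hb : ∀ ω, ‖(touchEvent E x).indicator (1 : BondConfig (Site 2) → ℝ) ω‖ ≤ 1 := fun ω => by
    by_cases hω : ω ∈ touchEvent E x
    · rw [Set.indicator_of_mem hω, Pi.one_apply, norm_one]
    · rw [Set.indicator_of_notMem hω, norm_zero]; exact zero_le_one
  have h := martingale_percSlitExpectation hE half hm hb
  have hfun : (fun n (ω₀ : BondConfig (Site 2)) =>
      touchProbPin E (ω₀ ∩ revealedFreeEdges hE ω₀ n) (revealedFreeEdges hE ω₀ n \ ω₀) x) =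
      fun n => percSlitExpectation hE half n ((touchEvent E x).indicator (1 : BondConfig (Site 2) → ℝ)) := by
    funext n ω₀
    exact (percSlitExpectation_indicator_touchEvent hE n x ω₀).symm
  rw [hfun]
  exact h

/-- **Conditional-expectation form**: `P(x ↔ A ∣ 𝓕_n)(ω₀) = touchProbPin E (ω₀ ∩ R_n) (R_n ∖ ω₀) x` for
`P_{1/2}`-a.e. `ω₀`, `𝓕_n` the exploration filtration. -/
theorem condExp_touchEvent_ae_eq_touchProbPin (hE : E.IsZdAdmissible) (n : ℕ) (x : Site 2) :
    Pc[(touchEvent E x).indicator (1 : BondConfig (Site 2) → ℝ) | explorationFiltration hE n] =ᵐ[Pc]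
      fun ω₀ => touchProbPin E (ω₀ ∩ revealedFreeEdges hE ω₀ n) (revealedFreeEdges hE ω₀ n \ ω₀) x := by
  have hm : StronglyMeasurable ((touchEvent E x).indicator (1 : BondConfig (Site 2) → ℝ)) :=
    (stronglyMeasurable_const (b := (1 : ℝ))).indicator (touchEvent_measurableSet E x)
  have hb : ∀ ω, ‖(touchEvent E x).indicator (1 : BondConfig (Site 2) → ℝ) ω‖ ≤ 1 := fun ω => by
    by_cases hω : ω ∈ touchEvent E x
    · rw [Set.indicator_of_mem hω, Pi.one_apply, norm_one]
    · rw [Set.indicator_of_notMem hω, norm_zero]; exact zero_le_one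
  have h := condExp_explorationFiltration_ae_eq_percSlitExpectation (hD := hE) half hm hb n
  refine h.trans (Filter.EventuallyEq.of_eq ?_)
  funext ω₀
  exact percSlitExpectation_indicator_touchEvent hE n x ω₀

/-! ### §3 The touch functional: the renormalised touch intensity is the expectation of a touch COUNT, and its
conditional expectations are the PINNED touch functionals -/

/-- For admissible data the touch sites form a finite set (`…IicTouchAudit.touchSites_finite`). -/
theorem touchSites_finite_of_isZdAdmissible (hE : E.IsZdAdmissible) : (touchSites E).Finite :=
  touchSites_finite E hE.isBounded hE.delta_pos

/-- The random TOUCH COUNT tested against `g`: `Z_E(g)(ω) = δ^{2/3} Σ_{x touch site, x ↔ A in ω} g(δx)` — the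
renormalised number of (weighted) free-arc sites at which the interface of `ω` touches the free arc (Duminil-Copin
2012, Prop. 5: touch at `x` iff `x ↔ A`); its expectation is `touchFunctional E g` and its scaling limit should be
the boundary touching measure of the limiting curve (dimension `2/3` for SLE₆). -/
def touchCount (E : DiscreteDobrushin) (g : ℂ → ℝ) (ω : BondConfig (Site 2)) : ℝ :=
  E.δ ^ ((2:ℝ) / 3) *
    ∑ᶠ x : Site 2, (touchSites E).indicator (fun x => (touchEvent E x).indicator (fun _ => g (meshPoint E.δ x)) ω) x

/-- The PINNED touch functional of the pinned datum `(E, O, C)`: `δ^{2/3} Σ_{x touch site} touchProbPin · g(δx)`. -/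
def touchFunctionalPin (E : DiscreteDobrushin) (O C : Set (Sym2 (Site 2))) (g : ℂ → ℝ) : ℝ :=
  E.δ ^ ((2:ℝ) / 3) *
    ∑ᶠ x : Site 2, (touchSites E).indicator (fun x => touchProbPin E O C x * g (meshPoint E.δ x)) x

/-- With nothing pinned the pinned touch functional is the line's `touchFunctional`. -/
theorem touchFunctionalPin_empty (E : DiscreteDobrushin) (g : ℂ → ℝ) :
    touchFunctionalPin E ∅ ∅ g = touchFunctional E g := by
  simp [touchFunctionalPin, touchFunctional, touchProbPin_empty]

/-- The touch count as a finite sum over the touch sites. -/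
theorem touchCount_eq_sum (hE : E.IsZdAdmissible) (g : ℂ → ℝ) (ω : BondConfig (Site 2)) :
    touchCount E g ω = E.δ ^ ((2:ℝ) / 3) *
      ∑ x ∈ (touchSites_finite_of_isZdAdmissible hE).toFinset, (touchEvent E x).indicator (fun _ => g (meshPoint E.δ x)) ω := by
  rw [touchCount, finsum_eq_sum_of_support_subset_of_finite _ (Set.support_indicator_subset) (touchSites_finite_of_isZdAdmissible hE)]
  congr 1
  refine Finset.sum_congr rfl fun x hx => ?_
  rw [Set.indicator_of_mem ((touchSites_finite_of_isZdAdmissible hE).mem_toFinset.1 hx)]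

/-- The pinned touch functional as a finite sum over the touch sites. -/
theorem touchFunctionalPin_eq_sum (hE : E.IsZdAdmissible) (O C : Set (Sym2 (Site 2))) (g : ℂ → ℝ) :
    touchFunctionalPin E O C g = E.δ ^ ((2:ℝ) / 3) *
      ∑ x ∈ (touchSites_finite_of_isZdAdmissible hE).toFinset, touchProbPin E O C x * g (meshPoint E.δ x) := by
  rw [touchFunctionalPin,
    finsum_eq_sum_of_support_subset_of_finite _ (Set.support_indicator_subset) (touchSites_finite_of_isZdAdmissible hE)]
  congr 1
  refine Finset.sum_congr rfl fun x hx => ?_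
  rw [Set.indicator_of_mem ((touchSites_finite_of_isZdAdmissible hE).mem_toFinset.1 hx)]

/-- The touch count is a measurable function of the configuration. -/
theorem measurable_touchCount (hE : E.IsZdAdmissible) (g : ℂ → ℝ) : Measurable (touchCount E g) := by
  have h : touchCount E g = fun ω => E.δ ^ ((2:ℝ) / 3) *
      ∑ x ∈ (touchSites_finite_of_isZdAdmissible hE).toFinset, (touchEvent E x).indicator (fun _ => g (meshPoint E.δ x)) ω :=
    funext (touchCount_eq_sum hE g)
  rw [h]
  exact measurable_const.mul
    (Finset.measurable_sum _ fun x _ => measurable_const.indicator (touchEvent_measurableSet E x))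

/-- The touch count is bounded: `|Z_E(g)(ω)| ≤ δ^{2/3} Σ_{x touch site} |g(δx)|`. -/
theorem norm_touchCount_le (hE : E.IsZdAdmissible) (g : ℂ → ℝ) (ω : BondConfig (Site 2)) :
    ‖touchCount E g ω‖ ≤ |E.δ ^ ((2:ℝ) / 3)| * ∑ x ∈ (touchSites_finite_of_isZdAdmissible hE).toFinset, |g (meshPoint E.δ x)| := by
  rw [touchCount_eq_sum hE, Real.norm_eq_abs, abs_mul]
  refine mul_le_mul_of_nonneg_left ((Finset.abs_sum_le_sum_abs _ _).trans (Finset.sum_le_sum fun x _ => ?_))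
    (abs_nonneg _)
  by_cases hω : ω ∈ touchEvent E x
  · rw [Set.indicator_of_mem hω]
  · rw [Set.indicator_of_notMem hω, abs_zero]; exact abs_nonneg _

/-- **The expectation of the pinned touch count is the pinned touch functional.** -/
theorem integral_touchCount_pin (hE : E.IsZdAdmissible) (O C : Set (Sym2 (Site 2))) (g : ℂ → ℝ) :
    ∫ ω, touchCount E g ((ω ∪ O) \ C) ∂Pc = touchFunctionalPin E O C g := by
  simp only [touchCount_eq_sum hE]
  rw [integral_const_mul, touchFunctionalPin_eq_sum hE]
  congr 1
  have hint : ∀ x ∈ (touchSites_finite_of_isZdAdmissible hE).toFinset, Integrable (fun ω : BondConfig (Site 2) =>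
      (touchEvent E x).indicator (fun _ => g (meshPoint E.δ x)) ((ω ∪ O) \ C)) Pc := by
    intro x _
    have hmeas : Measurable fun ω : BondConfig (Site 2) =>
        (touchEvent E x).indicator (fun _ => g (meshPoint E.δ x)) ((ω ∪ O) \ C) :=
      (measurable_const.indicator (touchEvent_measurableSet E x)).comp
        (CaratheodoryNetSlitUniformity.measurable_pin O C)
    refine Integrable.of_bound hmeas.aestronglyMeasurable (|g (meshPoint E.δ x)|) (ae_of_all _ fun ω => ?_)
    by_cases hω : (ω ∪ O) \ C ∈ touchEvent E x
    · simp only [Set.indicator_of_mem hω, Real.norm_eq_abs, le_refl]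
    · simp only [Set.indicator_of_notMem hω, norm_zero, abs_nonneg]
  rw [integral_finsetSum _ hint]
  refine Finset.sum_congr rfl fun x _ => ?_
  have hfun : (fun ω : BondConfig (Site 2) => (touchEvent E x).indicator (fun _ => g (meshPoint E.δ x)) ((ω ∪ O) \ C)) =
      {ω : BondConfig (Site 2) | (ω ∪ O) \ C ∈ touchEvent E x}.indicator fun _ => g (meshPoint E.δ x) := by
    funext ω
    set T : Set (BondConfig (Site 2)) := {ω : BondConfig (Site 2) | (ω ∪ O) \ C ∈ touchEvent E x} with hT
    by_cases hω : (ω ∪ O) \ C ∈ touchEvent E x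
    · have hωT : ω ∈ T := hω
      rw [Set.indicator_of_mem hω, Set.indicator_of_mem hωT]
    · have hωT : ω ∉ T := hω
      rw [Set.indicator_of_notMem hω, Set.indicator_of_notMem hωT]
  rw [hfun, integral_indicator_const _ (measurableSet_pin_mem_touchEvent E O C x), smul_eq_mul]
  rfl

/-- **The renormalised touch intensity is the expectation of the touch count**: `touchFunctional E g = E[Z_E(g)]`. -/
theorem touchFunctional_eq_integral_touchCount : ∀ {E : DiscreteDobrushin}, E.IsZdAdmissible → ∀ (g : ℂ → ℝ), touchFunctional E g = ∫ ω, touchCount E g ω ∂Pc := by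
  intro E hE g
  rw [← touchFunctionalPin_empty, ← integral_touchCount_pin hE ∅ ∅ g]
  simp

/-- **The slit expectation of the touch count is the pinned touch functional of the revealed data.** -/
theorem percSlitExpectation_touchCount (hE : E.IsZdAdmissible) (n : ℕ) (g : ℂ → ℝ) (ω₀ : BondConfig (Site 2)) :
    percSlitExpectation hE half n (touchCount E g) ω₀ =
      touchFunctionalPin E (ω₀ ∩ revealedFreeEdges hE ω₀ n) (revealedFreeEdges hE ω₀ n \ ω₀) g := by
  rw [percSlitExpectation_eq_integral_pin]
  exact integral_touchCount_pin hE _ _ g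

/-- **The touch-functional martingale of stub S6.** For admissible `E` and every test function `g`, the pinned
touch functionals of the data revealed by the exploration, `n ↦ (ω₀ ↦ touchFunctionalPin E (ω₀ ∩ R_n) (R_n ∖ ω₀) g)`,
form a martingale for the exploration filtration under `P_{1/2}` — the Doob martingale `E[Z_E(g) ∣ 𝓕_n]` of the
touch count; at `n = 0` it is `touchFunctional E g`. This is the discrete process whose scaling limit the
identification half of S6 must control UNIFORMLY IN THE PREFIX, i.e. over pinned slit data. -/
theorem martingale_touchFunctionalPin : ∀ {E : DiscreteDobrushin} (hE : E.IsZdAdmissible) (g : ℂ → ℝ), Martingale (fun n (ω₀ : BondConfig (Site 2)) => touchFunctionalPin E (ω₀ ∩ revealedFreeEdges hE ω₀ n) (revealedFreeEdges hE ω₀ n \ ω₀) g) (explorationFiltration hE) Pc := by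
  intro E hE g
  have h := martingale_percSlitExpectation hE half (measurable_touchCount hE g).stronglyMeasurable
    (norm_touchCount_le hE g)
  have hfun : (fun n (ω₀ : BondConfig (Site 2)) =>
      touchFunctionalPin E (ω₀ ∩ revealedFreeEdges hE ω₀ n) (revealedFreeEdges hE ω₀ n \ ω₀) g) =
      fun n => percSlitExpectation hE half n (touchCount E g) := by
    funext n ω₀
    exact (percSlitExpectation_touchCount hE n g ω₀).symm
  rw [hfun]
  exact h

/-- Conditional-expectation form: `E[Z_E(g) ∣ 𝓕_n](ω₀) = touchFunctionalPin E (ω₀ ∩ R_n) (R_n ∖ ω₀) g` a.e. -/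
theorem condExp_touchCount_ae_eq_touchFunctionalPin (hE : E.IsZdAdmissible) (n : ℕ) (g : ℂ → ℝ) :
    Pc[touchCount E g | explorationFiltration hE n] =ᵐ[Pc]
      fun ω₀ => touchFunctionalPin E (ω₀ ∩ revealedFreeEdges hE ω₀ n) (revealedFreeEdges hE ω₀ n \ ω₀) g := by
  have h := condExp_explorationFiltration_ae_eq_percSlitExpectation (hD := hE) half
    (measurable_touchCount hE g).stronglyMeasurable (norm_touchCount_le hE g) n
  refine h.trans (Filter.EventuallyEq.of_eq ?_)
  funext ω₀
  exact percSlitExpectation_touchCount hE n g ω₀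

/-! ### §4 Orientation audit: subsequential limits of the crux's interface functional start at `a` -/

/-- **Subsequential limit laws of the interface functional are carried by curves from `a = D.pt 0`** (the
source clause the identification half of S6 must feed into `IsSLELaw 6 D μ`; orientation check of the junk
audit: although for a counter-clockwise parametrised `D` the exploration runs `b → a`, `iface` re-orients by
the endpoint rule, `iface D Λ δ = bondInterfaceIn D (Λ δ)`, so `…LimitSource.ae_source_eq_of_tendsto_bondInterfaceIn`
applies verbatim). -/
theorem ae_source_eq_of_isSubseqLimitLaw : ∀ (D : DobrushinDomain) (Λ : ℝ → DiscreteDobrushin), IsFamily D Λ → ∀ (μ : Measure (CurveClass ℂ)) [IsFiniteMeasure μ], IsSubseqLimitLaw (iface D Λ) perc μ → ∀ᵐ c ∂μ, c.source = D.pt 0 := by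
  intro D Λ hΛ μ _ hμ
  obtain ⟨s, hs, hlim⟩ := hμ
  exact ae_source_eq_of_tendsto_bondInterfaceIn D Λ
    ⟨hΛ.1, hΛ.2.1, hΛ.2.2.1, hΛ.2.2.2.1, hΛ.2.2.2.2.1, hΛ.2.2.2.2.2⟩ s hs μ hlim

end Summit.CriticalPhenomena.CardyFormulaZ2.Cruxes.ParafermionToSLESixFamilies.IicTraceFluxPairing

end
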